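import Literature.NumberTheory.NumberFields.RayClassFieldLocalTowerContainment
import Literature.NumberTheory.NumberFields.RayClassFieldAdicCharacterLocalUnits
import Literature.NumberTheory.GaloisRepresentations.LubinTateTowerRelNorm
import Literature.NumberTheory.GaloisRepresentations.LubinTateUnramifiedRelativeGalois
import HarnessLib

/-!
# THE GLOBAL AND THE LOCAL TOWER ARE LINEARLY DISJOINT OVER EACH LEVEL, AND GLOBAL NORMS ARE LOCAL NORMS:
# `Gal(E·K_π^{m+1}/E·K_π^{n+1}) ≃ Gal(K(𝔪v^{m+1})/K(𝔪v^{n+1}))` along `ι : K̄ → K̄_v`, and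
# `ι(N_{K(𝔪v^{m+1})/K(𝔪v^{n+1})} x) = N_{E·K_π^{m+1}/E·K_π^{n+1}}(ι x)` — de Shalit II.1.10 / II.4.3–4.5 at the split prime

Setting of `RayClassFieldLocalTowerContainment.lean` (`K` totally complex, `𝔪 ≠ 0`, `v ∤ 𝔪`, `w_𝔪 = 1`, a
uniformiser `π` of `K_v` and `α ∈ 𝓞_K`, `α ≡ 1 mod 𝔪`, `(α) = 𝔭_v^f`, `α = π^f` in `K_v` — the ABSOLUTE
Lubin–Tate model; `E ≤ K_v^{nr}` finite Galois with `f ∣ deg w` for every Weil element fixing `E`).  That file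
proved `ι(K(𝔪v^{n+1})) ⊆ E·K_π^{n+1}` (`E·K_π^{n+1} = E ⊔ ltField π n`).  De Shalit II.1.10 says more:
the completion of `K(𝔣𝔭^{n+1})` at `𝔓` IS `Φ·k_ξ^{n+1}` and `𝔓` is totally ramified in the `𝔭`-division tower
(Corollary p. 39), so the relative Galois groups and the relative NORMS of the global tower `K(𝔪v^{n+1})` and of
the local tower `E·K_π^{n+1}` correspond under `ι`.  THIS file proves it:

* §1 ★ `toAbsGalois_mem_fixingSubgroup_ltField_of_mem_ker` — the CONVERSE of the Galois form of the containment: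
  a local Weil element `w` with `f ∣ deg w` whose restriction `res w` fixes `K(𝔪v^{n+1})` fixes `K_π^{n+1}`
  (`w = w₁·Φ^{-deg w}`, `Art(Φ) = π`; `[⟨Art w₁⁻¹⟩_v, K]` trivial on `K(𝔪v^{n+1})` forces — `Kˣ ∩ W_𝔪 = 1` —
  `Art(w₁) ≡ 1 mod v^{n+1}`, and `χ_π(w₁) = Art(w₁)` by Lubin–Tate reciprocity);
* §2 ★ `mem_fixingSubgroup_ltField_of_forall_smul_absClosureEmbedding_eq` — density upgrade: `τ ∈ Γ_{K_v}` fixing `E`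
  and fixing `ι(K(𝔪v^{n+1}))` pointwise fixes `K_π^{n+1}`; hence
  ★ `mem_fixingSubgroup_sup_ltField_of_forall_smul_absClosureEmbedding_eq`:
  **`ι(K(𝔪v^{m+1}))·E ⊇ E·K_π^{m+1}`** in Galois form (an element of `Γ_{K_v}` fixing `E` and `ι(K(𝔪v^{m+1}))` fixes
  `E·K_π^{m+1}`) — the local tower is generated by the global one over the unramified base;
* §3 ★ `exists_mem_inertia_absRestrictNormalHom_eq` — every `ρ ∈ Gal(K(𝔪v^{m+1})/K(𝔪v^{n+1}))` is the
  restriction of a local INERTIA element fixing `E·K_π^{n+1}` (inertia supply of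
  `RayClassFieldAdicCharacterDecomposition.lean` + §1);
* the sequel `RayClassFieldLocalTowerNorm.lean` deduces **the norm compatibility**
  `ι(N_{K(𝔪v^{m+1})/K(𝔪v^{n+1})} x) = N_{E·K_π^{m+1}/E·K_π^{n+1}}(ι x)` (the restriction
  `σ ↦ (res σ̃)|_{K(𝔪v^{m+1})}` is a bijection `Gal(E·K_π^{m+1}/E·K_π^{n+1}) → Gal(K(𝔪v^{m+1})/K(𝔪v^{n+1}))`
  by §2 (injective) and §3 (onto)).

This is the field-theoretic input that turns a norm-coherent sequence of GLOBAL units along `K(𝔪v^{m+1})`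
(elliptic units) into an element of the tree's `RelNormCoherentUnits hπ E` (brick B5 of the measure side of
de Shalit II.4).  Theorems only; no `sorry`.

## References
* [deShalit1987] E. de Shalit, *Iwasawa theory of elliptic curves with complex multiplication* (1987), I.1.8 (p. 11),
  II.1.10 Lemma and Corollary (p. 39), II.4.3–4.5 (p. 57–58), III.1.2 (2) (p. 101).
* [NeukirchANT1999] J. Neukirch, *Algebraic Number Theory* (1999), Ch. VI §5 Prop. (5.6), §7 Thm. (7.1), Ch. IV §1 (1.2).
* [CasselsFrohlichANT1967] Cassels–Fröhlich (1967), Ch. VI §3.4 Thm. 3, §3.6 Prop. 6, §3.7 Thm. 3.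
* [Corvallis1979] J. Tate, *Number theoretic background* (1979), (1.4.1) (`W_F` dense in `Γ_F`).
-/

noncomputable section

open NumberField IsDedekindDomain IsDedekindDomain.HeightOneSpectrum Field
open scoped nonZeroDivisors Classical

namespace Literature.NumberTheory.NumberFields

open Literature.NumberTheory.GaloisRepresentations
open Literature.NumberTheory.GaloisRepresentations.ArtinLocalGlobal
open Literature.NumberTheory.GaloisRepresentations.IsNonarchimedeanLocalField

variable {K : Type} [Field K] [NumberField K] {𝔪 : Ideal (𝓞 K)} {v : HeightOneSpectrum (𝓞 K)}

/-! ### §0. Local helpers -/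

/-- `deg (Φ ^ k) = k · deg Φ` for `k ∈ ℤ`. [folklore] -/
private theorem deg_zpow₁₀ (Φ : WeilGroup (v.adicCompletion K)) (k : ℤ) :
    WeilGroup.deg (Φ ^ k) = k * WeilGroup.deg Φ := by
  have h := map_zpow (WeilGroup.degHom (v.adicCompletion K) IsFrobPow.mul_holds IsFrobPow.unique_holds) Φ k
  rw [WeilGroup.degHom_apply, WeilGroup.degHom_apply, ← ofAdd_zsmul, smul_eq_mul] at h
  exact Multiplicative.ofAdd.injective h

omit [NumberField K] in
/-- `((τ|_L) x : K̄) = τ • x`. [folklore] -/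
private theorem coe_absRestrictNormalHom_apply₁₀ (L : IntermediateField K (AlgebraicClosure K)) [Normal K L]
    (τ : absoluteGaloisGroup K) (x : L) :
    ((absRestrictNormalHom L τ x : L) : AlgebraicClosure K) = τ • (x : AlgebraicClosure K) :=
  AlgEquiv.restrictNormalHom_apply L _ x

omit [NumberField K] in
/-- An element of `ker (res_L)` fixes `L` pointwise. [folklore] -/
private theorem smul_eq_of_mem_ker_absRestrictNormalHom₁₀ (L : IntermediateField K (AlgebraicClosure K)) [Normal K L]
    {τ : absoluteGaloisGroup K} (hτ : τ ∈ (absRestrictNormalHom L).ker) {x : AlgebraicClosure K} (hx : x ∈ L) :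
    τ • x = x := by
  rw [MonoidHom.mem_ker] at hτ
  rw [← coe_absRestrictNormalHom_apply₁₀ L τ ⟨x, hx⟩, hτ, AlgEquiv.one_apply]

omit [NumberField K] in
/-- An element fixing `L` pointwise lies in `ker (res_L)`. [folklore] -/
private theorem mem_ker_absRestrictNormalHom_of_forall_smul_eq₁₀ (L : IntermediateField K (AlgebraicClosure K))
    [Normal K L] {τ : absoluteGaloisGroup K} (h : ∀ x ∈ L, τ • x = x) :
    τ ∈ (absRestrictNormalHom L).ker := by
  rw [MonoidHom.mem_ker]
  ext x
  rw [coe_absRestrictNormalHom_apply₁₀, AlgEquiv.one_apply]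
  exact h x x.2

open ValuativeRel in
/-- **Discreteness**: `|x|_v ≤ |v^{n+1}| ⟹ π^{n+1} ∣ x` in `𝒪[K_v]` for a uniformiser `π`.
[cite: NeukirchANT1999, Ch. II §3 Prop. (3.8)] -/
theorem pow_dvd_of_valued_le_exp_neg {π : 𝒪[v.adicCompletion K]}
    (hπ : (valuation (v.adicCompletion K)).IsUniformizer (π : v.adicCompletion K)) {n : ℕ}
    {x : 𝒪[v.adicCompletion K]}
    (h : Valued.v ((x : 𝒪[v.adicCompletion K]) : v.adicCompletion K) ≤ WithZero.exp (-((n + 1 : ℕ) : ℤ))) :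
    π ^ (n + 1) ∣ x := by
  have hle : ∀ a b : v.adicCompletion K,
      valuation (v.adicCompletion K) a ≤ valuation (v.adicCompletion K) b ↔ Valued.v a ≤ Valued.v b := fun a b =>
    (Valuation.vle_iff_le (valuation (v.adicCompletion K))).symm.trans (Valuation.vle_iff_le Valued.v)
  have hπv : Valued.v (((π ^ (n + 1) : 𝒪[v.adicCompletion K]) : v.adicCompletion K)) =
      WithZero.exp (-((n + 1 : ℕ) : ℤ)) := by
    rw [SubmonoidClass.coe_pow, Valuation.map_pow, valued_eq_exp_neg_one_of_isUniformizer v hπ, ← WithZero.exp_nsmul]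
    congr 1; simp
  have h1 : Valued.v ((x : 𝒪[v.adicCompletion K]) : v.adicCompletion K) ≤
      Valued.v (((π ^ (n + 1) : 𝒪[v.adicCompletion K]) : v.adicCompletion K)) := by rw [hπv]; exact h
  exact (Valuation.Integers.le_iff_dvd (Valuation.integer.integers (valuation (v.adicCompletion K)))).mp
    ((hle _ _).mpr h1)

open ValuativeRel in
/-- **`χ_π(σ) ≡ 1 mod π^{n+1} ⟹ σ` fixes `K_π^{n+1}`** (`Gal(K_π^{n+1}/K_v) ≅ (𝒪/π^{n+1})ˣ` is injective:
`σ λ_{n+1} = [χ_π(σ)]_f λ_{n+1} = λ_{n+1}` and `K_π^{n+1} = K_v(λ_{n+1})`). [cite: CasselsFrohlichANT1967, Ch. VI §3.6 Prop. 6 (b)] -/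
theorem mem_fixingSubgroup_ltField_of_pow_dvd_lubinTateChar_sub_one {π : 𝒪[v.adicCompletion K]}
    (hπ : (valuation (v.adicCompletion K)).IsUniformizer (π : v.adicCompletion K)) {n : ℕ}
    {σ : absoluteGaloisGroup (v.adicCompletion K)}
    (h : π ^ (n + 1) ∣ (lubinTateChar hπ σ : 𝒪[v.adicCompletion K]) - 1) :
    σ ∈ (ltField π n).fixingSubgroup := by
  have h1 : ltAbsChar hπ n σ = 1 := by
    rw [← unitsModPow_lubinTateChar, ← map_one (unitsModPow π n), unitsModPow_eq_iff]
    simpa using h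
  have h2 : σ • ltRoot π n = ltRoot π n := (smul_ltRoot_eq_iff_ltAbsChar_eq_one hπ n σ).mpr h1
  have hbot : ∀ x : (⊥ : IntermediateField (v.adicCompletion K) (AlgebraicClosure (v.adicCompletion K))),
      σ • ((x : (⊥ : IntermediateField (v.adicCompletion K) (AlgebraicClosure (v.adicCompletion K)))) :
        AlgebraicClosure (v.adicCompletion K)) = x := by
    intro x
    obtain ⟨c, hc⟩ := IntermediateField.mem_bot.mp x.2
    rw [← hc, absoluteGaloisGroup.smul_def, AlgEquiv.commutes]
  have h3 := (forall_mem_sup_ltField_smul_eq_iff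
    (⊥ : IntermediateField (v.adicCompletion K) (AlgebraicClosure (v.adicCompletion K))) n (σ := σ) hbot).mpr h2
  exact (IntermediateField.mem_fixingSubgroup_iff _ _).mpr fun x hx ↦
    h3 x ((le_sup_right : ltField π n ≤ ⊥ ⊔ ltField π n) hx)

/-! ### §1. Converse Galois form: `res w` fixes `K(𝔪v^{n+1})` and `f ∣ deg w` ⟹ `w` fixes `K_π^{n+1}` -/

variable [IsTotallyComplex K]

open ValuativeRel in
/-- ★ **THE CONVERSE OF THE CONTAINMENT, Galois form.** `π` a uniformiser of `K_v`, `α ∈ 𝓞_K` with `α ≠ 0`,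
`α ≡ 1 mod 𝔪`, `α` a unit off `v`, `α = π^f` in `K_v`; `w_𝔪 = 1`.  A local Weil element `w` with `f ∣ deg w` whose
restriction `res w` fixes `K(𝔪v^{n+1})` fixes `K_π^{n+1}` pointwise (with `RayClassFieldLocalTowerContainment`:
`res w ∈ Gal(K̄/K(𝔪v^{n+1})) ⟺ w ∈ Gal(K̄_v/K_π^{n+1})` for such `w` — `𝔓` is totally ramified in the `𝔭`-division
tower, de Shalit II.1.10 Corollary). [cite: deShalit1987, II.1.10 Lemma and Corollary (p. 39), I.1.8 (p. 11)]
[cite: NeukirchANT1999, Ch. VI §5 Prop. (5.6), §7 Thm. (7.1)] [cite: CasselsFrohlichANT1967, Ch. VI §3.7 Thm. 3] -/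
theorem toAbsGalois_mem_fixingSubgroup_ltField_of_mem_ker (h𝔪 : 𝔪 ≠ ⊥) (hv : ¬ 𝔪 ≤ v.asIdeal)
    (hw : ∀ u : (𝓞 K)ˣ, (u : 𝓞 K) - 1 ∈ 𝔪 → u = 1)
    {π : 𝒪[v.adicCompletion K]} (hπ : (valuation (v.adicCompletion K)).IsUniformizer (π : v.adicCompletion K))
    {α : 𝓞 K} (hα0 : α ≠ 0) (hα𝔪 : α - 1 ∈ 𝔪) (hαw : ∀ w : HeightOneSpectrum (𝓞 K), w ≠ v → α ∉ w.asIdeal)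
    {f : ℕ} (hαπ : ((α : K) : v.adicCompletion K) = (π : v.adicCompletion K) ^ f)
    (n : ℕ) (w : WeilGroup (v.adicCompletion K)) (hdeg : (f : ℤ) ∣ WeilGroup.deg w)
    (hker : absGaloisRestrict K (v.adicCompletion K) (WeilGroup.toAbsGalois (v.adicCompletion K) w) ∈
      (absRestrictNormalHom (rayClassField K (𝔪 * v.asIdeal ^ (n + 1)))).ker) :
    WeilGroup.toAbsGalois (v.adicCompletion K) w ∈ (ltField π n).fixingSubgroup := by
  have ha := isLocalArtinMap_canonicalArtin_holds (v.adicCompletion K)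
  have h𝔑0 : 𝔪 * v.asIdeal ^ (n + 1) ≠ ⊥ := mul_ne_zero h𝔪 (pow_ne_zero _ v.ne_bot)
  -- a Frobenius `Φ` for `π`: `deg Φ = -1`, `Art Φ = π`; it fixes `K_π^{n+1}`
  obtain ⟨Φ, hΦdeg, hΦart⟩ := exists_deg_eq_neg_one_artin_eq ha
    (x := Units.mk0 (π : v.adicCompletion K) hπ.ne_zero) hπ
  have hΦfix : WeilGroup.toAbsGalois (v.adicCompletion K) Φ ∈ (ltField π n).fixingSubgroup :=
    toAbsGalois_mem_fixingSubgroup_ltField hπ ha hΦart n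
  -- `res (Φ^f)` fixes `K(𝔪v^{n+1})` (Frobenius clause: `Art(Φ^f) = π^f = α_v`)
  have hΦf : canonicalArtin (v.adicCompletion K) (Φ ^ f) =
      Units.mk0 ((α : K) : v.adicCompletion K) (by
        rw [← algebraMap_adicCompletion_apply, map_ne_zero_iff _ (algebraMap K (v.adicCompletion K)).injective]
        exact_mod_cast hα0) *
        Units.map ((v.adicCompletionIntegers K).subtype : v.adicCompletionIntegers K →* v.adicCompletion K)
          (1 : (v.adicCompletionIntegers K)ˣ) := by
    rw [map_one, mul_one, map_pow, hΦart]
    exact Units.ext (by rw [Units.val_pow_eq_pow_val, Units.val_mk0, Units.val_mk0, hαπ])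
  have hmemf : absGaloisRestrict K (v.adicCompletion K) (WeilGroup.toAbsGalois (v.adicCompletion K) (Φ ^ f)) ∈
      (absRestrictNormalHom (rayClassField K (𝔪 * v.asIdeal ^ (n + 1)))).ker := by
    rw [MonoidHom.mem_ker, absRestrictNormalHom_absGaloisRestrict_eq_of_artin_eq_mul h𝔑0
      (fun _ hwv ↦ modulusExp_mul_pow_of_ne h𝔪 (n + 1) hwv) ha hα0 hα𝔪 hαw (Φ ^ f) hΦf, inv_one, map_one, map_one,
      map_one, map_one]
  -- `w₁ := w · Φ^{deg w}` is an inertia element and `res w₁` still fixes `K(𝔪v^{n+1})`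
  obtain ⟨j, hj⟩ := hdeg
  set d := WeilGroup.deg w with hd
  have hdeg₁ : WeilGroup.deg (w * Φ ^ d) = 0 := by
    rw [WeilGroup.deg_mul IsFrobPow.mul_holds IsFrobPow.unique_holds, deg_zpow₁₀, hΦdeg]; ring
  have hw₁ : w * Φ ^ d ∈ WeilGroup.inertia (v.adicCompletion K) :=
    (WeilGroup.deg_eq_zero_iff_mem_inertia IsFrobPow.mul_holds IsFrobPow.unique_holds).mp hdeg₁
  have hker₁ : absGaloisRestrict K (v.adicCompletion K) (WeilGroup.toAbsGalois (v.adicCompletion K) (w * Φ ^ d)) ∈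
      (absRestrictNormalHom (rayClassField K (𝔪 * v.asIdeal ^ (n + 1)))).ker := by
    rw [hj, zpow_mul, zpow_natCast, map_mul, map_mul, map_zpow, map_zpow]
    exact Subgroup.mul_mem _ hker (Subgroup.zpow_mem _ hmemf j)
  -- `Art(w₁) = u`, and `[⟨u⁻¹⟩_v, K]` trivial on `K(𝔪v^{n+1})` forces `|u − 1| ≤ |v^{n+1}|` (`Kˣ ∩ W_𝔪 = 1`)
  obtain ⟨u, hu⟩ := exists_unitsMap_eq_artin_of_mem_inertia ha hw₁
  have hval' : Valued.v ((((u⁻¹ : (v.adicCompletionIntegers K)ˣ) : v.adicCompletionIntegers K) :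
      v.adicCompletion K) - 1) ≤ WithZero.exp (-((n + 1 : ℕ) : ℤ)) := by
    rw [← localUnits_integer_mem_rayUnitIdeles_mul_pow_iff h𝔪 hv (n + 1) u⁻¹,
      ← localUnits_integer_mem_sup_rayUnitIdeles_mul_pow_iff h𝔪 hv hw (n + 1) u⁻¹,
      ← (isAdicArtinValue_inv_of_mem_inertia ha (w * Φ ^ d) hu).mem_ker_iff_mem_sup (n + 1)]
    exact hker₁
  -- `|u − 1| = |u⁻¹ − 1|`
  have hu1 : Valued.v (((u : v.adicCompletionIntegers K) : v.adicCompletion K)) = 1 :=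
    adicCompletionIntegers.isUnit_iff_valued_eq_one.mp (Units.isUnit u)
  have hne : ((u : v.adicCompletionIntegers K) : v.adicCompletion K) ≠ 0 := fun h0 ↦ by
    rw [h0, map_zero] at hu1; exact zero_ne_one hu1
  have hinv : ((((u⁻¹ : (v.adicCompletionIntegers K)ˣ) : v.adicCompletionIntegers K) : v.adicCompletion K)) =
      (((u : v.adicCompletionIntegers K) : v.adicCompletion K))⁻¹ :=
    eq_inv_of_mul_eq_one_left (by
      rw [← MulMemClass.coe_mul, ← Units.val_mul, inv_mul_cancel, Units.val_one, OneMemClass.coe_one])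
  have hval : Valued.v ((((u : v.adicCompletionIntegers K) : v.adicCompletion K)) - 1) ≤
      WithZero.exp (-((n + 1 : ℕ) : ℤ)) := by
    have heq : ((((u : v.adicCompletionIntegers K) : v.adicCompletion K)) - 1) =
        (((u : v.adicCompletionIntegers K) : v.adicCompletion K)) *
          -(((((u⁻¹ : (v.adicCompletionIntegers K)ˣ) : v.adicCompletionIntegers K) : v.adicCompletion K)) - 1) := by
      rw [hinv]; field_simp; ring
    rw [heq, Valuation.map_mul, Valuation.map_neg, hu1, one_mul]
    exact hval'
  -- `χ_π(w₁) = Art(w₁) = u`, so `π^{n+1} ∣ χ_π(w₁) − 1` and `w₁` fixes `K_π^{n+1}`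
  have hχ : ((lubinTateChar hπ (WeilGroup.toAbsGalois (v.adicCompletion K) (w * Φ ^ d)) :
      𝒪[v.adicCompletion K]) : v.adicCompletion K) = ((u : v.adicCompletionIntegers K) : v.adicCompletion K) := by
    rw [coe_lubinTateChar_toAbsGalois_canonicalArtin hπ hw₁, ← hu]; rfl
  have hdvd : π ^ (n + 1) ∣
      (lubinTateChar hπ (WeilGroup.toAbsGalois (v.adicCompletion K) (w * Φ ^ d)) : 𝒪[v.adicCompletion K]) - 1 := by
    refine pow_dvd_of_valued_le_exp_neg hπ ?_
    rw [AddSubgroupClass.coe_sub, OneMemClass.coe_one, hχ]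
    exact hval
  have hw₁fix : WeilGroup.toAbsGalois (v.adicCompletion K) (w * Φ ^ d) ∈ (ltField π n).fixingSubgroup :=
    mem_fixingSubgroup_ltField_of_pow_dvd_lubinTateChar_sub_one hπ hdvd
  -- `w = w₁ · Φ^{-deg w}`
  have hw' : w = (w * Φ ^ d) * (Φ ^ d)⁻¹ := (mul_inv_cancel_right w (Φ ^ d)).symm
  rw [hw', map_mul, map_inv, map_zpow]
  exact Subgroup.mul_mem _ hw₁fix (Subgroup.inv_mem _ (Subgroup.zpow_mem _ hΦfix d))

/-! ### §2. Density upgrade: fixing `E` and `ι(K(𝔪v^{n+1}))` forces fixing `K_π^{n+1}`; linear disjointness -/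

open ValuativeRel in
/-- ★ **`τ ∈ Γ_{K_v}` fixing `E` and `ι(K(𝔪v^{n+1}))` pointwise fixes `K_π^{n+1}`** (`E` finite with `f ∣ deg w` for every
Weil `w` fixing `E`): the Weil elements are dense in `Γ_{K_v}`, the three conditions are open, and §1 applies to Weil
elements. So `ι(K(𝔪v^{n+1}))·E ⊇ K_π^{n+1}`: the local tower is GENERATED by the global one over the unramified base
(de Shalit II.1.10: `K(𝔣𝔭^{n+1})_𝔓 = Φ·k_ξ^{n+1}`). [cite: deShalit1987, II.1.10 Lemma (p. 39)] [cite: Corvallis1979, (1.4.1)] -/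
theorem mem_fixingSubgroup_ltField_of_forall_smul_absClosureEmbedding_eq (h𝔪 : 𝔪 ≠ ⊥) (hv : ¬ 𝔪 ≤ v.asIdeal)
    (hw : ∀ u : (𝓞 K)ˣ, (u : 𝓞 K) - 1 ∈ 𝔪 → u = 1)
    {π : 𝒪[v.adicCompletion K]} (hπ : (valuation (v.adicCompletion K)).IsUniformizer (π : v.adicCompletion K))
    {α : 𝓞 K} (hα0 : α ≠ 0) (hα𝔪 : α - 1 ∈ 𝔪) (hαw : ∀ w : HeightOneSpectrum (𝓞 K), w ≠ v → α ∉ w.asIdeal)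
    {f : ℕ} (hαπ : ((α : K) : v.adicCompletion K) = (π : v.adicCompletion K) ^ f)
    (E : IntermediateField (v.adicCompletion K) (AlgebraicClosure (v.adicCompletion K)))
    [FiniteDimensional (v.adicCompletion K) E]
    (hdegE : ∀ w : WeilGroup (v.adicCompletion K),
      WeilGroup.toAbsGalois (v.adicCompletion K) w ∈ E.fixingSubgroup → (f : ℤ) ∣ WeilGroup.deg w)
    (n : ℕ) {τ : absoluteGaloisGroup (v.adicCompletion K)} (hτE : τ ∈ E.fixingSubgroup)
    (hτfix : ∀ x ∈ rayClassField K (𝔪 * v.asIdeal ^ (n + 1)),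
      τ • absClosureEmbedding K (v.adicCompletion K) x = absClosureEmbedding K (v.adicCompletion K) x) :
    τ ∈ (ltField π n).fixingSubgroup := by
  by_contra hcon
  -- the three conditions cut out an open subset of `K̄_v ≃ₐ[K_v] K̄_v` containing `τ`
  set L := rayClassField K (𝔪 * v.asIdeal ^ (n + 1)) with hL
  have hopen₂ : IsOpen ((fun σ : AlgebraicClosure (v.adicCompletion K) ≃ₐ[v.adicCompletion K]
      AlgebraicClosure (v.adicCompletion K) ↦ absGaloisRestrict K (v.adicCompletion K) σ) ⁻¹'
        (((absRestrictNormalHom L).ker : Subgroup (absoluteGaloisGroup K)) : Set (absoluteGaloisGroup K))) :=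
    (isOpen_ker_absRestrictNormalHom L).preimage (absGaloisRestrict K (v.adicCompletion K)).continuous
  have hopen := ((IntermediateField.fixingSubgroup_isOpen E).inter hopen₂).inter
    (Subgroup.isClosed_of_isOpen _ (IntermediateField.fixingSubgroup_isOpen (ltField π n))).isOpen_compl
  have hτ₂ : absGaloisRestrict K (v.adicCompletion K) τ ∈ (absRestrictNormalHom L).ker := by
    refine mem_ker_absRestrictNormalHom_of_forall_smul_eq₁₀ L fun x hx ↦ ?_
    apply (absClosureEmbedding K (v.adicCompletion K)).injective
    have h := hτfix x hx
    rwa [← absGaloisRestrict_apply_smul] at h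
  have hd0 := WeilGroup.denseRange_toAbsGalois_holds (v.adicCompletion K)
  dsimp only [WeilGroup.denseRange_toAbsGalois] at hd0
  have hd : DenseRange (fun w : WeilGroup (v.adicCompletion K) ↦
      absoluteGaloisGroup.toAlgEquiv (v.adicCompletion K) (WeilGroup.toAbsGalois (v.adicCompletion K) w)) := hd0
  obtain ⟨w, ⟨⟨hwE, hwL⟩, hwπ⟩⟩ := hd.exists_mem_open hopen
    ⟨absoluteGaloisGroup.toAlgEquiv (v.adicCompletion K) τ, ⟨⟨hτE, hτ₂⟩, hcon⟩⟩
  apply hwπ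
  exact toAbsGalois_mem_fixingSubgroup_ltField_of_mem_ker h𝔪 hv hw hπ hα0 hα𝔪 hαw hαπ n w (hdegE w hwE) hwL

open ValuativeRel in
/-- ★ **LINEAR DISJOINTNESS `ι(K(𝔪v^{m+1}))·(E·K_π^{n+1}) = E·K_π^{m+1}`, Galois form**: an element of `Γ_{K_v}` fixing
`E ⊔ ltField π n` and `ι(K(𝔪v^{m+1}))` pointwise fixes `E ⊔ ltField π m` pointwise (any `n`, `m`; only `m` matters).
[cite: deShalit1987, II.1.10 Lemma and Corollary (p. 39), II.4.5 (p. 58)] -/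
theorem mem_fixingSubgroup_sup_ltField_of_forall_smul_absClosureEmbedding_eq (h𝔪 : 𝔪 ≠ ⊥) (hv : ¬ 𝔪 ≤ v.asIdeal)
    (hw : ∀ u : (𝓞 K)ˣ, (u : 𝓞 K) - 1 ∈ 𝔪 → u = 1)
    {π : 𝒪[v.adicCompletion K]} (hπ : (valuation (v.adicCompletion K)).IsUniformizer (π : v.adicCompletion K))
    {α : 𝓞 K} (hα0 : α ≠ 0) (hα𝔪 : α - 1 ∈ 𝔪) (hαw : ∀ w : HeightOneSpectrum (𝓞 K), w ≠ v → α ∉ w.asIdeal)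
    {f : ℕ} (hαπ : ((α : K) : v.adicCompletion K) = (π : v.adicCompletion K) ^ f)
    (E : IntermediateField (v.adicCompletion K) (AlgebraicClosure (v.adicCompletion K)))
    [FiniteDimensional (v.adicCompletion K) E]
    (hdegE : ∀ w : WeilGroup (v.adicCompletion K),
      WeilGroup.toAbsGalois (v.adicCompletion K) w ∈ E.fixingSubgroup → (f : ℤ) ∣ WeilGroup.deg w)
    (m : ℕ) {τ : absoluteGaloisGroup (v.adicCompletion K)} (hτE : τ ∈ E.fixingSubgroup)
    (hτfix : ∀ x ∈ rayClassField K (𝔪 * v.asIdeal ^ (m + 1)),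
      τ • absClosureEmbedding K (v.adicCompletion K) x = absClosureEmbedding K (v.adicCompletion K) x) :
    τ ∈ (E ⊔ ltField π m : IntermediateField (v.adicCompletion K) (AlgebraicClosure (v.adicCompletion K))).fixingSubgroup := by
  rw [IntermediateField.fixingSubgroup_sup]
  exact ⟨hτE, mem_fixingSubgroup_ltField_of_forall_smul_absClosureEmbedding_eq h𝔪 hv hw hπ hα0 hα𝔪 hαw hαπ E hdegE m
    hτE hτfix⟩

/-! ### §3. Onto: every `ρ ∈ Gal(K(𝔪v^{m+1})/K(𝔪v^{n+1}))` is the restriction of a local inertia element fixing `E·K_π^{n+1}` -/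

open ValuativeRel in
/-- ★ **Inertia supply for the relative Galois groups**: for `ρ ∈ Gal(K(𝔪v^{m+1})/K)` fixing `K(𝔪v^{n+1})` there is a
local INERTIA element `w` with `res w|_{K(𝔪v^{m+1})} = ρ` which fixes `E ⊔ ltField π n` (`E ≤ K_v^{nr}`): the relative
group `Gal(K(𝔪v^{m+1})/K(𝔪v^{n+1}))` is the image of `Gal(K̄_v/E·K_π^{n+1}) ∩ I_{K_v}` (de Shalit II.1.10 Corollary: `𝔓`
is totally ramified in the `𝔭`-division tower). [cite: deShalit1987, II.1.10 Corollary (p. 39)]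
[cite: NeukirchANT1999, Ch. VI §5 Prop. (5.6), §7 Thm. (7.1)] -/
theorem exists_mem_inertia_absRestrictNormalHom_eq (h𝔪 : 𝔪 ≠ ⊥) (hv : ¬ 𝔪 ≤ v.asIdeal)
    (hw : ∀ u : (𝓞 K)ˣ, (u : 𝓞 K) - 1 ∈ 𝔪 → u = 1)
    {π : 𝒪[v.adicCompletion K]} (hπ : (valuation (v.adicCompletion K)).IsUniformizer (π : v.adicCompletion K))
    {α : 𝓞 K} (hα0 : α ≠ 0) (hα𝔪 : α - 1 ∈ 𝔪) (hαw : ∀ w : HeightOneSpectrum (𝓞 K), w ≠ v → α ∉ w.asIdeal)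
    {f : ℕ} (hαπ : ((α : K) : v.adicCompletion K) = (π : v.adicCompletion K) ^ f)
    {E : IntermediateField (v.adicCompletion K) (AlgebraicClosure (v.adicCompletion K))}
    (hE : E ≤ maxUnramified (v.adicCompletion K))
    {n m : ℕ} (hnm : n ≤ m)
    (ρ : rayClassField K (𝔪 * v.asIdeal ^ (m + 1)) ≃ₐ[K] rayClassField K (𝔪 * v.asIdeal ^ (m + 1)))
    (hρ : ∀ y : rayClassField K (𝔪 * v.asIdeal ^ (m + 1)),
      (y : AlgebraicClosure K) ∈ rayClassField K (𝔪 * v.asIdeal ^ (n + 1)) →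
        ((ρ y : rayClassField K (𝔪 * v.asIdeal ^ (m + 1))) : AlgebraicClosure K) = y) :
    ∃ (w : WeilGroup (v.adicCompletion K)), w ∈ WeilGroup.inertia (v.adicCompletion K) ∧
      absRestrictNormalHom (rayClassField K (𝔪 * v.asIdeal ^ (m + 1)))
          (absGaloisRestrict K (v.adicCompletion K) (WeilGroup.toAbsGalois (v.adicCompletion K) w)) = ρ ∧
      WeilGroup.toAbsGalois (v.adicCompletion K) w ∈
        (E ⊔ ltField π n : IntermediateField (v.adicCompletion K) (AlgebraicClosure (v.adicCompletion K))).fixingSubgroup := by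
  have ha := isLocalArtinMap_canonicalArtin_holds (v.adicCompletion K)
  have hle : rayClassField K (𝔪 * v.asIdeal ^ (n + 1)) ≤ rayClassField K (𝔪 * v.asIdeal ^ (m + 1)) :=
    rayClassField_le_of_le (mul_ne_zero h𝔪 (pow_ne_zero _ v.ne_bot))
      (Ideal.mul_mono_right (Ideal.pow_le_pow_right (by omega)))
  -- lift `ρ` to `g ∈ Γ_K`; it fixes `K(𝔪v^{n+1})`, hence `K(𝔪)`
  obtain ⟨g, hg⟩ : ∃ g : absoluteGaloisGroup K, absRestrictNormalHom (rayClassField K (𝔪 * v.asIdeal ^ (m + 1))) g = ρ := by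
    obtain ⟨g₀, hg₀⟩ := AlgEquiv.restrictNormalHom_surjective (F := K) (E := AlgebraicClosure K)
      (K₁ := rayClassField K (𝔪 * v.asIdeal ^ (m + 1))) ρ
    exact ⟨(absoluteGaloisGroup.toAlgEquiv K).symm g₀, by
      rw [absRestrictNormalHom, MonoidHom.comp_apply, MulEquiv.toMonoidHom_eq_coe, MonoidHom.coe_coe,
        MulEquiv.apply_symm_apply, hg₀]⟩
  have hgn : g ∈ (absRestrictNormalHom (rayClassField K (𝔪 * v.asIdeal ^ (n + 1)))).ker := by
    refine mem_ker_absRestrictNormalHom_of_forall_smul_eq₁₀ _ fun x hx ↦ ?_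
    have h1 : ((absRestrictNormalHom (rayClassField K (𝔪 * v.asIdeal ^ (m + 1))) g ⟨x, hle hx⟩ :
        rayClassField K (𝔪 * v.asIdeal ^ (m + 1))) : AlgebraicClosure K) =
        ((ρ ⟨x, hle hx⟩ : rayClassField K (𝔪 * v.asIdeal ^ (m + 1))) : AlgebraicClosure K) := by rw [hg]
    rw [coe_absRestrictNormalHom_apply₁₀] at h1
    rw [h1]
    exact hρ ⟨x, hle hx⟩ hx
  have hg𝔪 : g ∈ (absRestrictNormalHom (rayClassField K 𝔪)).ker :=
    ker_absRestrictNormalHom_rayClassField_anti (mul_ne_zero h𝔪 (pow_ne_zero _ v.ne_bot)) Ideal.mul_le_right hgn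
  -- an inertia element acting like `g` on the whole `v`-ray tower above `K(𝔪)`
  obtain ⟨w, hwI, -, hwg⟩ := exists_mem_inertia_forall_absRestrictNormalHom_eq h𝔪 hv hw ha ⟨g, hg𝔪⟩
  refine ⟨w, hwI, ?_, ?_⟩
  · rw [hwg (m + 1)]; exact hg
  · -- `w` fixes `E` (inertia, `E ≤ K_v^{nr}`) and `K_π^{n+1}` (§1 at level `n`: `res w` fixes `K(𝔪v^{n+1})`, `deg w = 0`)
    rw [IntermediateField.fixingSubgroup_sup]
    refine ⟨(IntermediateField.mem_fixingSubgroup_iff _ _).mpr fun x hx ↦ smul_coe_eq_of_mem_inertia v hwI hE ⟨x, hx⟩, ?_⟩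
    refine toAbsGalois_mem_fixingSubgroup_ltField_of_mem_ker h𝔪 hv hw hπ hα0 hα𝔪 hαw hαπ n w ?_ ?_
    · rw [(WeilGroup.deg_eq_zero_iff_mem_inertia IsFrobPow.mul_holds IsFrobPow.unique_holds).mpr hwI]
      exact dvd_zero _
    · rw [MonoidHom.mem_ker, hwg (n + 1)]
      exact hgn

end Literature.NumberTheory.NumberFields

end
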